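import Summits.HodgeConjecture.HodgeConjecture.Theorems.Ring2AbelianAllSpreadFloorCollapse
import Summits.HodgeConjecture.HodgeConjecture.Theorems.Ring2AbelianAllSpreadDiagonalLiftHodge
import HarnessLib

/-!
# Ring 2 · AbelianAll · SPREADING axis, part XXIII — THE THREE ANCHORED FLOOR NODES ARE ONE STATEMENT (fact-free):
# `F_CM ⟺ F_CM^prim ⟺ F_CM^{prim,ev}` (census N1 ≡ N102 ≡ N103), the successor of part XVII with its displayed hypothesis
# `(PL)` DISCHARGED by the diagonal lift `(PL-Δ)` of parts XIX–XXII

research route, not a corollary; conditional on HC_CM plus one named minimal statement.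
(Cell line: research route conditional on HC_CM; not a corollary; Q11.4-sentence-2 already refuted in dim ≥ 3.)

Seat `pub-hodge-ring2-ab-spread-1` (SPREADING), generation 27. Nothing in this file is a case of the Hodge conjecture.
`HC_CM` = `Theses.RankFourFaces.CMAbelianHodge` does NOT occur in this file; `HC_AV` = `Theses.PadicSemiregularLift.HodgeAbelianVarieties`
does not occur either; the item `Theses.RankFourFaces.CMToAbelian` (stmt-HodgeConjecture-16267) stays OPEN. No definition, no new
named fact, no sorry, no new node, NO displayed hypothesis: every row below is a plain kernel row.

## What this file does

Part XVII proved `F_CM^{prim,ev} ⟹ F_CM^prim ⟹ F_CM` MODULO a displayed binder `(PL)` ("every rational `(p,p)` class, `p ≥ 2`, is the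
pull-back along `(𝟙,0) : A ⟶ A × B` of a rational `(p,p)` class primitive for some hard-Lefschetz datum of an even-dimensional `A × B`
of dimension `≥ 2p`"). Part XVII §1 (`IsCMAnchoredDatumFor.comap`, `not_mem_algebraicClasses_of_map_eq`) is stated for an ARBITRARY
homomorphism `ι : A ⟶ A'`, and part XXII proves the lift along the DIAGONAL `Δ : A ⟶ A^{2p}` as a theorem (`exists_primitiveLift`:
`A' = A^{2p}` of even dimension `2p · dim A ≥ 2p`; the lift is rational, of type `(p,p)` and primitive for the box datum of parts
XVIII/XX by the Leibniz rule of part XIX). Hence: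
* §1 `exists_isCMAnchoredDatumFor_of_evenPrimitiveHodgeFailureSpreadsToCMFibre` — the core transport of XVII §2 with `(PL)` replaced by
  `(PL-Δ)`: from `F_CM^{prim,ev}` ALONE, every non-algebraic rational `(p,p)` class with `p ≥ 2` on every complex abelian variety has a
  CM-pointed anchored datum with a CM failure (the case `dim A = 0` is vacuous: `H^{2p}(pt) = 0`).
* §2 the edges UP the binder ladder, now plain: `F_CM^{prim,ev} ⟹ F_CM^prim` (N103 → N102) and — with Lefschetz (1,1) for `p = 1`, the
  tree theorem `lefschetzOneOne_rational_holds`, and `N⁰H⁰ = ⊤` for `p = 0` — `F_CM^{prim,ev} ⟹ F_CM` (N103 → N1), `F_CM^prim ⟹ F_CM`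
  (N102 → N1).
* §3 collapse: `F_CM ⟺ F_CM^prim`, `F_CM ⟺ F_CM^{prim,ev}`, `F_CM^prim ⟺ F_CM^{prim,ev}` and the conjunction
  `spreadFloor_nodes_collapse` — with parts XIV/XV's fact-free downward edges.

## Honest column

EVERY row is **K** (kernel, fact-free, no displayed binder): the modulus `(PL)` of part XVII is discharged by parts XIX–XXII (all
fact-free tree theorems over the tree's Hodge-theory layer; Lefschetz (1,1) enters §2–§3 only through the tree theorem
`lefschetzOneOne_rational_holds` — count once, the discharge is that file's). CONSEQUENCE FOR THE CENSUS (to be entered by the census of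
record, not by this pen): the three anchored floor nodes N1 `HodgeFailureSpreadsToCMFibre`, N102 `PrimitiveHodgeFailureSpreadsToCMFibre`,
N103 `EvenPrimitiveHodgeFailureSpreadsToCMFibre` are now joined by kernel `↔` edges free of `HC_CM` — they are ONE statement up to
fact-free equivalence. What this does NOT do: it does not make `B_min` smaller. The restriction of the floor to primitive classes in
even dimension `≥ 2p` was a change of BINDER, not of strength; the `B_min` of record (least typed node, census v44: N103) is therefore
EQUIVALENT to the plain anchored floor `F_CM` (N1) — "minimal" is claimed for nothing, "strictly smaller than `F_CM`" is now REFUTED as a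
reading of N103 (it is not smaller at all), and no typed node strictly below this class is known to this pen. Parts VII, XIV, XV, XVI,
XVII untouched (XVII's K[PL] rows remain correct and are superseded, not contradicted).
[cite: Andre1996Motifs, §1.3 (p. 12)] [cite: VoisinHodgeI2002, §6.2.3, Thm. 11.30, Cor. 11.34 and §11.3.3]
[cite: Deligne1982HodgeCycles, Prop. 6.1] [cite: LangeBirkenhake1992, §1.4 and Thm. 4.2.1]
-/

set_option linter.dupNamespace false

namespace Summit.HodgeConjecture.HodgeConjecture.Ring2.AbelianAll

open CategoryTheory AlgebraicGeometry
open Literature.AlgebraicGeometry Literature.AlgebraicGeometry.Motives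
open Literature.AlgebraicGeometry.HodgeTheory
open Literature.AlgebraicTopology.SingularHomology (singularCohomology)
open Literature.AlgebraicGeometry.Deligne1982 (cmLocus)
open Summit.HodgeConjecture.HodgeConjecture

variable {𝒳 S : SchemeOver ℂ}

/-! ## §1 The core transport, now unconditional -/

/-- **Every non-algebraic rational `(p,p)` class with `p ≥ 2` on every complex abelian variety has a CM-pointed anchored datum with a
CM failure — from `F_CM^{prim,ev}` ALONE.** If `dim A = 0` there is no offender (`H^{2p}(A) = 0`). Otherwise lift `c` along the
diagonal to a rational `(p,p)` class `c'` on `A' = A^{2p}`, primitive for a hard-Lefschetz datum, `dim A'` even and `≥ 2p`, with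
`Δ^* c' = c` (part XXII `exists_primitiveLift`); `c'` is not algebraic (XVII §1); `F_CM^{prim,ev}` anchors `c'` with a CM failure;
pull the anchor back along `Δ` (XVII §1). NO fact, NO displayed hypothesis. [cite: Andre1996Motifs, §1.3 (p. 12)]
[cite: VoisinHodgeI2002, §6.2.3 and §11.3.3] -/
theorem exists_isCMAnchoredDatumFor_of_evenPrimitiveHodgeFailureSpreadsToCMFibre
    (h : EvenPrimitiveHodgeFailureSpreadsToCMFibre) (A : AbelianVariety ℂ) {p : ℕ} (hp : 2 ≤ p)
    (c : complexBetti A.X (2 * p)) (hc : IsRationalClass c) (hpp : IsOfHodgeType A.dim A.X (2 * p) p p c)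
    (hnc : c ∉ algebraicClasses A.X p) :
    ∃ (n : ℕ) (𝒳 S : SchemeOver ℂ) (f : 𝒳 ⟶ S) (s : ComplexPoints S) (W : complexBetti 𝒳 (2 * p)),
      IsCMAnchoredDatumFor A p c f n s W ∧
        ∃ s' ∈ cmLocus f n, complexBetti.map (fiberι f s') (2 * p) W ∉ algebraicClasses (fiberOver f s') p := by
  rcases Nat.eq_zero_or_pos A.dim with hA | hA
  · exfalso
    haveI : Subsingleton (complexBetti A.X (2 * p)) :=
      ComplexPoints.subsingleton_singularCohomology_of_lt (AbelianVariety.isSmoothProjective_holds (A := A)) ℂ (by omega)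
    exact hnc (by rw [Subsingleton.elim c 0]; exact Submodule.zero_mem _)
  · obtain ⟨A', ι, Λ', c', hev, hle, hc'rat, hc'pp, hc'prim, hι⟩ := exists_primitiveLift A hA (by omega) c hc hpp
    have hX' : IsSmoothProjective A'.dim A'.X := AbelianVariety.isSmoothProjective_holds
    have hc'nc : c' ∉ algebraicClasses A'.X p := not_mem_algebraicClasses_of_map_eq ι hι hnc
    obtain ⟨n, 𝒳, S, f, s, W, hdat, hfail⟩ := h A' hX' hev Λ' p hp hle c' hc'rat hc'pp hc'prim hc'nc
    exact ⟨n, 𝒳, S, f, s, W, hdat.comap ι hι, hfail⟩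

/-! ## §2 Edges UP the binder ladder (plain kernel rows) -/

/-- **`F_CM^{prim,ev} ⟹ F_CM^prim` (census N103 → N102), fact-free.** The converse is part XV's fact-free
`evenPrimitiveHodgeFailureSpreadsToCMFibre_of_primitiveHodgeFailureSpreadsToCMFibre`. [folklore] -/
theorem primitiveHodgeFailureSpreadsToCMFibre_of_evenPrimitiveHodgeFailureSpreadsToCMFibre
    (h : EvenPrimitiveHodgeFailureSpreadsToCMFibre) : PrimitiveHodgeFailureSpreadsToCMFibre :=
  fun A _ _ _ hp _ c hc hpp _ hnc ↦
    exists_isCMAnchoredDatumFor_of_evenPrimitiveHodgeFailureSpreadsToCMFibre h A hp c hc hpp hnc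

/-- **`F_CM^{prim,ev} ⟹ F_CM` (census N103 → N1) with Lefschetz (1,1) displayed**: an offender `c ∈ H²ᵖ(A)` has `p ≠ 0`
(`N⁰ H⁰ = ⊤`) and `p ≠ 1` (`hL`, Lefschetz's theorem on `(1,1)`-classes — a tree theorem, supplied by name below), so `p ≥ 2` and §1
applies. [cite: VoisinHodgeI2002, Thm. 11.30, Cor. 11.34 and §11.3.3] -/
theorem hodgeFailureSpreadsToCMFibre_of_evenPrimitiveHodgeFailureSpreadsToCMFibre_of_lefschetzOneOne
    (hL : lefschetzOneOne_rational) (h : EvenPrimitiveHodgeFailureSpreadsToCMFibre) : HodgeFailureSpreadsToCMFibre := by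
  intro A hA p c hc hpp hnc
  rcases Nat.lt_or_ge p 2 with hp | hp
  · exfalso
    interval_cases p
    · exact hnc (by rw [algebraicClasses_zero]; trivial)
    · exact hnc (hL hA c hc hpp)
  · exact exists_isCMAnchoredDatumFor_of_evenPrimitiveHodgeFailureSpreadsToCMFibre h A hp c hc hpp hnc

/-- **`F_CM^{prim,ev} ⟹ F_CM` (census N103 → N1), fact-free**: the previous row with `hL := lefschetzOneOne_rational_holds` (tree
theorem; count once). The converse is part XV's `evenPrimitiveHodgeFailureSpreadsToCMFibre_of_hodgeFailureSpreadsToCMFibre`.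
[cite: VoisinHodgeI2002, Thm. 11.30, Cor. 11.34 and §11.3.3] -/
theorem hodgeFailureSpreadsToCMFibre_of_evenPrimitiveHodgeFailureSpreadsToCMFibre
    (h : EvenPrimitiveHodgeFailureSpreadsToCMFibre) : HodgeFailureSpreadsToCMFibre :=
  hodgeFailureSpreadsToCMFibre_of_evenPrimitiveHodgeFailureSpreadsToCMFibre_of_lefschetzOneOne
    lefschetzOneOne_rational_holds h

/-- **`F_CM^prim ⟹ F_CM` (census N102 → N1), fact-free**: part XV's fact-free `F_CM^prim ⟹ F_CM^{prim,ev}` and the previous row.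
The converse is part XIV's `primitiveHodgeFailureSpreadsToCMFibre_of_hodgeFailureSpreadsToCMFibre`.
[cite: VoisinHodgeI2002, Thm. 11.30, Cor. 11.34 and §11.3.3] -/
theorem hodgeFailureSpreadsToCMFibre_of_primitiveHodgeFailureSpreadsToCMFibre
    (h : PrimitiveHodgeFailureSpreadsToCMFibre) : HodgeFailureSpreadsToCMFibre :=
  hodgeFailureSpreadsToCMFibre_of_evenPrimitiveHodgeFailureSpreadsToCMFibre
    (evenPrimitiveHodgeFailureSpreadsToCMFibre_of_primitiveHodgeFailureSpreadsToCMFibre h)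

/-! ## §3 Collapse (plain kernel rows) -/

/-- **`F_CM ⟺ F_CM^prim` (N1 ≡ N102), fact-free.** [cite: VoisinHodgeI2002, §6.2.3 and §11.3.3] -/
theorem hodgeFailureSpreadsToCMFibre_iff_primitiveHodgeFailureSpreadsToCMFibre :
    HodgeFailureSpreadsToCMFibre ↔ PrimitiveHodgeFailureSpreadsToCMFibre :=
  ⟨primitiveHodgeFailureSpreadsToCMFibre_of_hodgeFailureSpreadsToCMFibre,
    hodgeFailureSpreadsToCMFibre_of_primitiveHodgeFailureSpreadsToCMFibre⟩

/-- **`F_CM^prim ⟺ F_CM^{prim,ev}` (N102 ≡ N103), fact-free.** [folklore] -/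
theorem primitiveHodgeFailureSpreadsToCMFibre_iff_evenPrimitiveHodgeFailureSpreadsToCMFibre :
    PrimitiveHodgeFailureSpreadsToCMFibre ↔ EvenPrimitiveHodgeFailureSpreadsToCMFibre :=
  ⟨evenPrimitiveHodgeFailureSpreadsToCMFibre_of_primitiveHodgeFailureSpreadsToCMFibre,
    primitiveHodgeFailureSpreadsToCMFibre_of_evenPrimitiveHodgeFailureSpreadsToCMFibre⟩

/-- **`F_CM ⟺ F_CM^{prim,ev}` (N1 ≡ N103), fact-free.** With part XV's `HC_AV_iff_HC_CM_and_evenPrimitiveHodgeFailureSpreadsToCMFibre`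
this is the typed content of "the primitive / even restriction of the anchored floor is a change of binder, not of strength".
`B_min` of record is NOT made smaller by this row: N103 ≡ N1. [cite: Andre1996Motifs, §1.3 (p. 12)]
[cite: VoisinHodgeI2002, §6.2.3, Thm. 11.30 and §11.3.3] -/
theorem hodgeFailureSpreadsToCMFibre_iff_evenPrimitiveHodgeFailureSpreadsToCMFibre :
    HodgeFailureSpreadsToCMFibre ↔ EvenPrimitiveHodgeFailureSpreadsToCMFibre :=
  ⟨evenPrimitiveHodgeFailureSpreadsToCMFibre_of_hodgeFailureSpreadsToCMFibre,
    hodgeFailureSpreadsToCMFibre_of_evenPrimitiveHodgeFailureSpreadsToCMFibre⟩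

/-- **THE THREE ANCHORED FLOOR NODES ARE ONE STATEMENT** (census N1 ≡ N102 ≡ N103), fact-free and free of `HC_CM`:
`(F_CM ↔ F_CM^prim) ∧ (F_CM^prim ↔ F_CM^{prim,ev})`. Part XVII's `spreadFloor_nodes_collapse_of_primitiveLiftToProduct` with its
displayed `(PL)` discharged by the diagonal lift of parts XIX–XXII. `B_min` of record NOT made smaller ("minimal" claimed for nothing;
N103 is not strictly below N1 — it is equivalent to it). [cite: Andre1996Motifs, §1.3 (p. 12)] [cite: VoisinHodgeI2002, §6.2.3 and §11.3.3] -/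
theorem spreadFloor_nodes_collapse :
    (HodgeFailureSpreadsToCMFibre ↔ PrimitiveHodgeFailureSpreadsToCMFibre) ∧
      (PrimitiveHodgeFailureSpreadsToCMFibre ↔ EvenPrimitiveHodgeFailureSpreadsToCMFibre) :=
  ⟨hodgeFailureSpreadsToCMFibre_iff_primitiveHodgeFailureSpreadsToCMFibre,
    primitiveHodgeFailureSpreadsToCMFibre_iff_evenPrimitiveHodgeFailureSpreadsToCMFibre⟩

end Summit.HodgeConjecture.HodgeConjecture.Ring2.AbelianAll
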